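import Literature.MathematicalPhysics.QuantumFieldTheory.Balaban1983to89.Node00.CarriersB8CubeDented
import Literature.MathematicalPhysics.QuantumFieldTheory.Balaban1983to89.B8Eq131CubesAdmissibleRec
import Literature.MathematicalPhysics.QuantumFieldTheory.Balaban1983to89.B8Eq138LandauZdRec
import Literature.MathematicalPhysics.QuantumFieldTheory.Balaban1983to89.B8Ineq133Rec
import Literature.MathematicalPhysics.QuantumFieldTheory.Balaban1983to89.B7SectEFLinearisationRec

/-!
# NODE 00 — [Balaban1985Variational] (144)–(153)'s DENTED cube datum and [Balaban1985RegularSpaces] Prop. 6's conclusion (1.135)–(1.138) read on its tower, FOR THE RECORD's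
# AVERAGING STRUCTURE ([Balaban1987RG1] (0.3)–(0.4): CENTRED blocks, symmetric loop averages, centre-rooted axial data): `CubeB8DZ`, `GaugedBoundB8DZ` = the record twins of
# `Node00.CubeB8D ∕ GaugedBoundB8D` (`Node00/CarriersB8CubeDented`) — THE R6∕R7 INTERFACE of the «N05-REC» road (what the R6 re-key concludes, what the R7 door consumes)

[6] = [Balaban1985RegularSpaces] Sect. F pp. 98–99, (1.131)–(1.138); [15] = [Balaban1985Variational] Sect. 3 pp. 300–301, (144)–(153); [I] = [Balaban1987RG1] (0.3)–(0.4) pp. 252–253.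
CITATION HEADER (lean-in-tree rule).  Cell `pub-ymgap` (HUMAN RULING D-0062), «N05-REC» road (director-ym №254∕№255; LEAD PEN dag-n05-e: `N05-REC-LEAD.md` TOKEN RULE T1–T6,
`N05-REC-INVENTORY.md` §R6 rows `Node00.CubeB8D ∕ GaugedBoundB8D ∕ gaugedBoundB8D_intro`); typed by the R7 pen dag-n07-w3 g10 as the INPUT TYPE of the R7 door (this lineage's g8
pattern `Node00.TorusCoverLandau153TowerMember.exists_localGauge152_tower_member (hG : <∃-body of GaugedBoundB8 …>)`: the door takes the crown body as a HYPOTHESIS, so it is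
typable as soon as this carrier exists; R6 then concludes `GaugedBoundB8DZ`).  DEFINITIONS + `rfl` ∕ set-algebra bookkeeping; `--kind definition --supports stmt-QuantumFields-20541`.

THE TOKEN MAP (engine `Node00/CarriersB8CubeDented` → this file; everything else BYTE FOR BYTE, in particular the class-0 letters `gaugeAct cfgExp logCfg mlogCfg msup bondNorm
covDerivFwd pdiv plaqCovDeriv covLap iEta mlog SideTouches AgreeOn InBox e tLo tHi ctr unitaryUnits InAk` (T6)):  (T1) `avgIter ↦ avgIterZ`, `logCovIter ↦ logCovIterZ`, `localGauge ↦
localGaugeZ`, `cutFixed ↦ cutFixedZ`, `Restr129 ↦ Restr129Z`, `IsLandau138W ↦ IsLandau138WZ`;  (T2) `tcube cube box ↦ tcubeZ cubeZ boxZ`, `sqLo sqHi inLo inHi bLo bHi ↦ …Z`, `cubeFam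
↦ cubeFamZ`, `Under ↦ UnderZ` (centred blocks `Bᵐ(y)`), `blockMap (Lᵏ) ↦ flmZ L k` (centred block label), `B8Ineq130.tlo ∕ thi ↦ B8Ineq130Rec.tlo ∕ thi`;  (T5) `CubeB8D ↦ CubeB8DZ`,
`GaugedBoundB8D ↦ GaugedBoundB8DZ`, `gaugedBoundB8D_intro ↦ gaugedBoundB8DZ_intro`; field-like abbreviations and reading lemmas keep their names in `namespace CubeB8DZ`.

WHAT THIS MODULE DEFINES ∕ PROVES (sorry-free).  §1 `CubeB8DZ d L K Ω` (fields `k a M ρ one_le_k k_le L_le_ρ ρ_le_M big L_le_dM` verbatim; `tcube_sub : tcubeZ … ⊆ Ω (k−1)`;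
`blocks : flmZ L k x = flmZ L k y → x ∈ Ω k → y ∈ Ω k`), `sq j := cubeFamZ false … j ∩ {j = k → · ∈ Ω_k}`, `inTop`, `lamS` (the engine comprehension, centred label boxes ∕ blocks),
`vfix axial dprime fixed expo`; readings `sq_top sq_of_lt sq_zero sq_subset_cubeFam sq_subset_cube sq_subset_omega_pred box_subset_omega_pred sq_succ_subset sq_eq_cubeFam_of_subset blocks_under inTop_flm_of_mem
sq_top_blockSat mem_sq_top_of_inTop mem_lamS_pred_iff mem_lamS_top_iff under_lamS_top_subset` (the centred-tower ones carry `Odd L`; `sq_of_gt ∕ lamS_of_gt ∕ sq_top_subset_omega` are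
OMITTED — the gate's dedup lint identifies them with the engine's — and are one-liners for a consumer: `by ext; simp [CubeB8DZ.sq, cubeFam_of_lt …]`, `fun _ hx => hx.2 rfl`;
`lamS_of_succ_lt ∕ lamS_top_subset`, which read n05-c's `cubeLam ∕ cubeLamS` — not yet twinned — are left to `B8CubeMemberZdRec`).  §2 `GaugedBoundB8DZ L η U₀ c r`
— the TWELVE CLAUSES of `GaugedBoundB8D` under the token map ((1.29) `Restr129Z`, (1.138)∕(153) `IsLandau138WZ`, the window of (1.135) on the CENTRED `□̃`, (1.137) with `logCovIterZ ∕
avgIterZ`), `gaugedBoundB8DZ_intro` (the `_iff` form is `Iff.rfl`, omitted for length), `GaugedBoundB8DZ.exists_restr129`, `CubeB8DZ.inAk`.  §3 non-vacuity `CubeB8DZ.ofUniv ∕ ofUniv_k ∕ nonempty_of_univ`.  §4 THE (T2)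
DICTIONARY (odd `L`) back to ENGINE letters for the SAME datum `(a, M, ρ, k)` under `x ↦ x + ctrShift L k·𝟙`: ★ `CubeB8DZ.mem_sq_iff_add_ctrShift`, ★ `CubeB8DZ.inTop_iff_under_add_ctrShift`,
`CubeB8DZ.blocks_flm_add_ctrShift` (via `B8Eq131CubesRecDictionary`); the translated-ambient-family repackaging `CubeB8DZ → CubeB8D` is the R7 door's business, not done here.

HONEST SCOPE ∕ LOCATED.  (a) DEFINITIONS and set bookkeeping only; NO estimate; [6] Prop. 6 ∕ Thm. 2 and [15] (152)–(153) on the dented record tower are NOT asserted —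
`GaugedBoundB8DZ` is the statement the R6 re-key (LEAD PEN dag-n05-e) is to CONCLUDE and the R7 door (dag-n07-w3) CONSUMES as a hypothesis; (b) the clause TEXTS are the engine's
under the LEAD's token map and are the LEAD's to amend (append-only editions follow any amendment); (c) the block law is the CENTRED one ([I] (0.3)); under the (T2) translation
it is the engine's law for the translated family (§4); (d) `ℤᵈ` carriers — the torus reading (TOP-ANCHORED lift `x ↦ cover (x + c_k·𝟙)`) is the R7 door's; (e) `HThm4Rec`
UNDISCHARGED (caveat (C-S3-1)); N05 ∕ N07 NOT discharged; counts unmoved; one finite 𝕋⁴ programme at fixed ε — R4 closes the conditional finite-𝕋⁴ rung `BalabanLadder.UV` only;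
the YM mass gap (Clay) is NOT proved by any of this; nothing continuum ∕ ℝ⁴ ∕ OS.  No `sorry`, no `axiom`, no `instance`, no `notation`.
-/

noncomputable section

namespace Literature.MathematicalPhysics.QuantumFieldTheory.Balaban1983to89.Node00

open MatrixLog (mlog)
open B7Prop1Explicit (gaugeAct e)
open B7Prop2Explicit (unitaryUnits)
open B7Prop1Local (InBox AgreeOn)
open BlockAveragingZd (avgIterZ ctrShift)
open B8LeafModelZd3 (mlogCfg)
open B8Ineq132 (InAk covDerivFwd Under)
open B8Ineq133Rec (cutFixedZ)
open B8Eq115GaugeFixingRec (localGaugeZ)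
open B8Eq119TwistedAxialRec (UnderZ flmZ Restr129Z underZ_flmZ underZ_iff_flmZ_eq)
open B8Eq184Proof (cfgExp)
open B8Eq140Level (SideTouches)
open B8Eq138LandauZd (logCfg covLap)
open B8Eq138LandauZdRec (IsLandau138WZ)
open B8Eq146AExpansion (iEta plaqCovDeriv)
open B8Eq143PlaqExpansion (pdiv)
open B7SectEFLinearisationRec (logCovIterZ)
open B8ScaledSupNorm (bondNorm msup)
open B8Eq131Cubes (tLo tHi ctr flm)
open B8Eq131CubesAdmissible (cubeFam)
open B8Eq131CubesRec (boxZ cubeZ tcubeZ bLoZ bHiZ sqLoZ sqHiZ inLoZ inHiZ)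
open B8Eq131CubesAdmissibleRec (cubeFamZ)

/-! ## §1. The dented cube datum `CubeB8DZ`, its tower `sq` and its cells `lamS` — record structure -/

section Cube

variable {d : ℕ}

/-- (RECORD TWIN of `Node00.CubeB8D`.) **A CUBE `□` OF [15] p. 300 («a cube □ intersecting Ω_j but not Ω_{j+1}») inside an ambient admissible family `{Ω_j}_{j ≤ K}`, FOR THE
RECORD's CENTRED TOWER**: the scale index `k`, the lower corner `a` and the side `M` of `□^{(k)} = [a, a + M)ᵈ`, the collar width `ρ = R₁M₁` with `L ≤ ρ ≤ M`, the (1.130)-step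
conditions `11d < M`, `L ≤ dM`, «□̃ ⊂ Ω_{k−1}» for the CENTRED blow-up `□̃ = B8Eq131CubesRec.tcubeZ` ((144)), and the ONE block law of the dent: `Ω_k` is a union of CENTRED
`k`-blocks `Bᵏ(y) = {x : flmZ L k x = y}` ([6] (1.3) «Ω_j = Bʲ(Ω_j^{(j)})», [I] (0.3)).  The pure datum's «□ ⊂ Ω_k» is NOT required.
[cite: Balaban1985Variational, p.300 («Let us take a cube □ intersecting Ω_j but not Ω_{j+1}»), (144) p.300; Balaban1985RegularSpaces, p.98, (1.3) p.77; Balaban1987RG1, (0.3) p.252] -/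
structure CubeB8DZ (d L K : ℕ) (Ω : ℕ → Set (B7Prop1Explicit.Site d)) : Type where
  /-- scale index of `□` (print's `j`, renamed `k`) -/
  k : ℕ
  /-- lower corner of `□^{(k)} = [a, a + M)ᵈ` -/
  a : B7Prop1Explicit.Site d
  /-- side `M` of `□^{(k)}` -/
  M : ℕ
  /-- `ρ = R₁M₁`, the width of the collars `□_j \ □_{j+1}` -/
  ρ : ℕ
  one_le_k : 1 ≤ k
  k_le : k ≤ K
  L_le_ρ : L ≤ ρ
  ρ_le_M : ρ ≤ M
  big : 11 * d < M
  L_le_dM : L ≤ d * M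
  /-- «□̃ ⊂ Ω_{k−1}» ((144)), centred blow-up -/
  tcube_sub : tcubeZ L a M ρ k ⊆ Ω (k - 1)
  /-- «Ω_k = Bᵏ(Ω_k^{(k)})»: `Ω_k` is saturated for the CENTRED `Lᵏ`-blocks of the fine lattice ((1.3), [I] (0.3)) -/
  blocks : ∀ ⦃x y : B7Prop1Explicit.Site d⦄, flmZ L k x = flmZ L k y → x ∈ Ω k → y ∈ Ω k

namespace CubeB8DZ

variable {L K : ℕ} {Ω : ℕ → Set (B7Prop1Explicit.Site d)} (c : CubeB8DZ d L K Ω)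

/-- **THE DENTED TOWER `{Ω′_j}_{j ≤ k}` of [15] (148)–(150), record structure**: `Ω′_j = □_j` (`cubeFamZ false`) for `j ≠ k`, `Ω′_k = □_k ∩ Ω_k`.
[cite: Balaban1985Variational, (148)–(150) p.301 («Ω′_j = □_j, j = 0, 1, …, k − 1»); Balaban1985RegularSpaces, (1.131) p.99; Balaban1987RG1, (0.3) p.252] -/
def sq : ℕ → Set (B7Prop1Explicit.Site d) := fun j => cubeFamZ false L c.a c.M c.ρ c.k j ∩ {x | j = c.k → x ∈ Ω c.k}

/-- «the CENTRED `k`-block over the level-`k` label `x` lies in `Ω_k`» (`Bᵏ(x) ⊂ Ω_k`). [cite: Balaban1985RegularSpaces, (1.3)/(1.6) p.77; Balaban1987RG1, (0.3) p.252] -/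
def inTop (x : B7Prop1Explicit.Site d) : Prop := ∀ z, UnderZ L c.k x z → z ∈ Ω c.k

/-- **THE CELLS `Λ′_j` OF THE DENTED TOWER, record structure** (level-`j` labels, CENTRED label boxes `sqLoZ ∕ sqHiZ ∕ inLoZ ∕ inHiZ`, centred blocks `UnderZ`): the engine
comprehension of `CubeB8D.lamS` under the token map. [cite: Balaban1985Variational, (148) p.301, (152) p.301 («ū_j = 1 on Λ′_j»); Balaban1985RegularSpaces, (1.131) p.99, (1.5) p.77; Balaban1987RG1, (0.3) p.252] -/
def lamS : ℕ → Set (B7Prop1Explicit.Site d) := fun j =>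
  if j ≤ c.k then
    {z | InBox (sqLoZ L c.a c.ρ c.k j) (sqHiZ L c.a c.M c.ρ c.k j) z ∧ (j = c.k → ∀ x, UnderZ L j z x → x ∈ Ω c.k) ∧
      (j < c.k → ¬ (InBox (inLoZ L c.a c.ρ c.k j) (inHiZ L c.a c.M c.ρ c.k j) z ∧ (j + 1 = c.k → ∀ x, UnderZ L j z x → x ∈ Ω c.k)))}
  else ∅

variable {𝔸 : Type*} [CStarAlgebra 𝔸]

/-- The gauge transformation `v : U₀ ↦ U₀′` of [6] p. 98 ∕ [15] p. 300 FOR THE RECORD: dag-n05-d's `localGaugeZ` on the centred `□̃` at depth `k` with centre `y` (token (T1)).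
[cite: Balaban1985RegularSpaces, p.98; Balaban1985Variational, p.300 (sentence before (145)); Balaban1987RG1, (0.4) p.253] -/
abbrev vfix (U₀ : B7Prop1Explicit.Site d → Fin d → 𝔸ˣ) : B7Prop1Explicit.Site d → 𝔸ˣ := localGaugeZ L (tLo c.a c.ρ) (tHi c.a c.M c.ρ) U₀ c.k (ctr c.a c.M)

/-- `U₀′ = U₀^{v}`. [cite: Balaban1985RegularSpaces, p.98, (1.129) p.98] -/
abbrev axial (U₀ : B7Prop1Explicit.Site d → Fin d → 𝔸ˣ) : B7Prop1Explicit.Site d → Fin d → 𝔸ˣ := gaugeAct (c.vfix U₀) U₀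

/-- `U₀″` := `U₀′` on `□̃`, `1` outside — dag-n05-d's `cutFixedZ` (token (T1)). [cite: Balaban1985RegularSpaces, p.99; Balaban1985Variational, (149) p.301; Balaban1987RG1, (0.4) p.253] -/
abbrev dprime (U₀ : B7Prop1Explicit.Site d → Fin d → 𝔸ˣ) : B7Prop1Explicit.Site d → Fin d → 𝔸ˣ := cutFixedZ L (tLo c.a c.ρ) (tHi c.a c.M c.ρ) U₀ c.k (ctr c.a c.M)

/-- `U₁ = U₀″^{u⁻¹}`. [cite: Balaban1985RegularSpaces, p.99] -/
abbrev fixed (U₀ : B7Prop1Explicit.Site d → Fin d → 𝔸ˣ) (u : B7Prop1Explicit.Site d → 𝔸ˣ) : B7Prop1Explicit.Site d → Fin d → 𝔸ˣ := gaugeAct u⁻¹ (c.dprime U₀)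

/-- The exponent `A = (1/iη) log U₁` of (1.135)∕(152), masked to the sides touching the DENTED record tower. [cite: Balaban1985RegularSpaces, (1.135) p.99; Balaban1985Variational, (152) p.301] -/
abbrev expo (η : ℝ) (U₀ : B7Prop1Explicit.Site d → Fin d → 𝔸ˣ) (u : B7Prop1Explicit.Site d → 𝔸ˣ) : B7Prop1Explicit.Site d → Fin d → 𝔸 :=
  mlogCfg c.k η c.sq (c.fixed U₀ u)

/-! ### The tower: readings -/

/-- `Ω′_k = □_k ∩ Ω_k`. [cite: Balaban1985Variational, (148)–(150) p.301] -/
theorem sq_top : c.sq c.k = cubeZ L c.a c.M c.ρ c.k c.k ∩ Ω c.k := by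
  ext x
  simp [CubeB8DZ.sq, B8Eq131CubesAdmissibleRec.cubeFam_false_of_le L c.a c.M c.ρ (le_refl c.k)]

/-- `Ω′_j = □_j` for `j < k`. [cite: Balaban1985Variational, (150) p.301 («Ω′_j = □_j, j = 0, 1, …, k − 1»)] -/
theorem sq_of_lt {j : ℕ} (hj : j < c.k) : c.sq j = cubeZ L c.a c.M c.ρ c.k j := by
  ext x
  simp [sq, B8Eq131CubesAdmissibleRec.cubeFam_false_of_le L c.a c.M c.ρ hj.le, Nat.ne_of_lt hj]

/-- `Ω′₀ = □₀` (`k ≥ 1`). [cite: Balaban1985Variational, (150) p.301; Balaban1985RegularSpaces, p.98] -/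
theorem sq_zero : c.sq 0 = cubeZ L c.a c.M c.ρ c.k 0 := c.sq_of_lt c.one_le_k

/-- `Ω′_j ⊆ □_j`: the dented tower lies inside the pure tower, level by level. [cite: Balaban1985Variational, (148)–(150) p.301] -/
theorem sq_subset_cubeFam (j : ℕ) : c.sq j ⊆ cubeFamZ false L c.a c.M c.ρ c.k j := fun _ hx => hx.1

/-- `Ω′_j ⊆ □_j` for `j ≤ k`, in `cubeZ` letters. [cite: Balaban1985Variational, (148)–(150) p.301] -/
theorem sq_subset_cube {j : ℕ} (hj : j ≤ c.k) : c.sq j ⊆ cubeZ L c.a c.M c.ρ c.k j := by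
  rw [← B8Eq131CubesAdmissibleRec.cubeFam_false_of_le L c.a c.M c.ρ hj]; exact c.sq_subset_cubeFam j

/-- `Ω′_j ⊆ □̃ ⊆ Ω_{k−1}` for every `j ≤ k` (odd `L ≥ 2`). [cite: Balaban1985Variational, (144) p.300 («□̃ ⊂ … ⊂ Ω_{j−1}»); Balaban1985RegularSpaces, p.98; Balaban1987RG1, (0.3) p.252] -/
theorem sq_subset_omega_pred (hLo : Odd L) (hL : 2 ≤ L) {j : ℕ} (hj : j ≤ c.k) : c.sq j ⊆ Ω (c.k - 1) :=
  ((c.sq_subset_cube hj).trans (B8Eq131CubesRec.cube_subset_tcube hLo hL (le_trans (le_trans one_le_two hL) c.L_le_ρ) hj)).trans c.tcube_sub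

/-- `□ ⊆ Ω_{k−1}` (odd `L ≥ 2`). [cite: Balaban1985Variational, (144) p.300; Balaban1987RG1, (0.3) p.252] -/
theorem box_subset_omega_pred (hLo : Odd L) (hL : 2 ≤ L) : boxZ L c.a c.M c.k ⊆ Ω (c.k - 1) :=
  ((B8Eq131CubesRec.box_subset_cube_top hLo c.a c.M c.ρ c.k).trans
    (B8Eq131CubesRec.cube_subset_tcube hLo hL (le_trans (le_trans one_le_two hL) c.L_le_ρ) le_rfl)).trans c.tcube_sub

/-- The dented tower is nested: `Ω′_{j+1} ⊆ Ω′_j` (odd `L`). [cite: Balaban1985RegularSpaces, (1.3) p.77; Balaban1985Variational, (144) p.300] -/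
theorem sq_succ_subset (hLo : Odd L) (j : ℕ) : c.sq (j + 1) ⊆ c.sq j := by
  intro x hx
  by_cases hj : j + 1 ≤ c.k
  · have hjk : j ≠ c.k := by omega
    refine ⟨?_, fun h => (hjk h).elim⟩
    rw [B8Eq131CubesAdmissibleRec.cubeFam_false_of_le L c.a c.M c.ρ (by omega)]
    have hx1 := hx.1
    rw [B8Eq131CubesAdmissibleRec.cubeFam_false_of_le L c.a c.M c.ρ hj] at hx1
    exact B8Eq131CubesRec.cube_anti hLo (Nat.le_succ j) hj hx1
  · have hgt : c.sq (j + 1) = ∅ := by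
      ext y; simp [sq, B8Eq131CubesAdmissibleRec.cubeFam_of_lt false L c.a c.M c.ρ (show c.k < j + 1 by omega)]
    rw [hgt] at hx
    exact hx.elim

/-- **EMPTY DENT = the PURE TOWER**: if `□_k ⊆ Ω_k` the dented tower IS `cubeFamZ false` at every level. [cite: Balaban1985RegularSpaces, (1.131) p.99; Balaban1985Variational, (150) p.301] -/
theorem sq_eq_cubeFam_of_subset (h : cubeZ L c.a c.M c.ρ c.k c.k ⊆ Ω c.k) (j : ℕ) : c.sq j = cubeFamZ false L c.a c.M c.ρ c.k j := by
  ext x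
  refine ⟨fun hx => hx.1, fun hx => ⟨hx, fun hj => ?_⟩⟩
  subst hj
  rw [B8Eq131CubesAdmissibleRec.cubeFam_false_of_le L c.a c.M c.ρ le_rfl] at hx
  exact h hx

/-- The block law in the tower's `UnderZ ∕ flmZ` spelling: a site of `Ω_k` carries its whole CENTRED `k`-block into `Ω_k` (odd `L`). [cite: Balaban1985RegularSpaces, (1.3) p.77; Balaban1987RG1, (0.3) p.252] -/
theorem blocks_under (hLo : Odd L) {x x' : B7Prop1Explicit.Site d} (hx : x ∈ Ω c.k) (hx' : UnderZ L c.k (flmZ L c.k x) x') : x' ∈ Ω c.k :=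
  c.blocks ((underZ_iff_flmZ_eq hLo c.k _ _).1 hx').symm hx

/-- A site of `Ω_k` has its centred `k`-block in `Ω_k`: `inTop (flmZ L k x)` (odd `L`). [cite: Balaban1985RegularSpaces, (1.3) p.77; Balaban1987RG1, (0.3) p.252] -/
theorem inTop_flm_of_mem (hLo : Odd L) {x : B7Prop1Explicit.Site d} (hx : x ∈ Ω c.k) : c.inTop (flmZ L c.k x) :=
  fun _ hz => c.blocks_under hLo hx hz

/-- **THE DENTED TOP IS A UNION OF CENTRED `k`-BLOCKS**: `Ω′_k = □_k ∩ Ω_k` is saturated for the centred `Lᵏ`-blocks (odd `L`; dag-n05-d's `B8Eq131CubesRec.mem_cube_iff` and the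
field `blocks`). [cite: Balaban1985RegularSpaces, (1.3) p.77, p.98 («for every j the cube □_j is a sum of the big blocks of the lattice T_{L^{−j}}»); Balaban1987RG1, (0.3) p.252] -/
theorem sq_top_blockSat (hLo : Odd L) {x x' : B7Prop1Explicit.Site d} (hx : x ∈ c.sq c.k) (hx' : UnderZ L c.k (flmZ L c.k x) x') : x' ∈ c.sq c.k := by
  rw [sq_top] at hx ⊢
  refine ⟨?_, c.blocks_under hLo hx.2 hx'⟩
  obtain ⟨z, hz, hzx⟩ := (B8Eq131CubesRec.mem_cube_iff hLo).1 hx.1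
  have hzf : flmZ L c.k x = z := (underZ_iff_flmZ_eq hLo c.k z x).1 hzx
  exact (B8Eq131CubesRec.mem_cube_iff hLo).2 ⟨z, hz, hzf ▸ hx'⟩

/-- A fine site under a level-`k` label of `□_k^{(k)}` whose centred block lies in `Ω_k` is in the dented top (odd `L`). [cite: Balaban1985Variational, (148) p.301; Balaban1987RG1, (0.3) p.252] -/
theorem mem_sq_top_of_inTop (hLo : Odd L) {z x : B7Prop1Explicit.Site d} (hz : InBox (sqLoZ L c.a c.ρ c.k c.k) (sqHiZ L c.a c.M c.ρ c.k c.k) z)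
    (hin : c.inTop z) (hx : UnderZ L c.k z x) : x ∈ c.sq c.k := by
  rw [sq_top]
  exact ⟨(B8Eq131CubesRec.mem_cube_iff hLo).2 ⟨z, hz, hx⟩, hin x hx⟩

/-! ### The cells: readings -/

/-- The level-`(k−1)` cells: labels of `□_{k−1}^{(k−1)}` whose centred block is not a block of `Ω′_k = □_k ∩ Ω_k`. [cite: Balaban1985Variational, (148) p.301; Balaban1985RegularSpaces, (1.131) p.99] -/
theorem mem_lamS_pred_iff (z : B7Prop1Explicit.Site d) :
    z ∈ c.lamS (c.k - 1) ↔ InBox (sqLoZ L c.a c.ρ c.k (c.k - 1)) (sqHiZ L c.a c.M c.ρ c.k (c.k - 1)) z ∧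
      ¬ (InBox (inLoZ L c.a c.ρ c.k (c.k - 1)) (inHiZ L c.a c.M c.ρ c.k (c.k - 1)) z ∧ ∀ x, UnderZ L (c.k - 1) z x → x ∈ Ω c.k) := by
  have hk := c.one_le_k
  have h1 : c.k - 1 ≤ c.k := Nat.sub_le _ _
  have h2 : c.k - 1 ≠ c.k := by omega
  have h3 : c.k - 1 < c.k := by omega
  have h4 : c.k - 1 + 1 = c.k := by omega
  simp [lamS, h1, h2, h3, h4]

/-- The level-`k` cells: labels of `□_k^{(k)}` whose centred `k`-block lies in `Ω_k`. [cite: Balaban1985Variational, (148) p.301; Balaban1985RegularSpaces, (1.131) p.99 («Λ′_k = □_k^{(k)}»)] -/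
theorem mem_lamS_top_iff (z : B7Prop1Explicit.Site d) :
    z ∈ c.lamS c.k ↔ InBox (sqLoZ L c.a c.ρ c.k c.k) (sqHiZ L c.a c.M c.ρ c.k c.k) z ∧ c.inTop z := by
  simp [lamS, inTop]

/-- A fine site under a level-`k` cell lies in the dented top `Ω′_k` (odd `L`). [cite: Balaban1985RegularSpaces, (1.5)–(1.6) p.77; Balaban1987RG1, (0.3) p.252] -/
theorem under_lamS_top_subset (hLo : Odd L) {z x : B7Prop1Explicit.Site d} (hz : z ∈ c.lamS c.k) (hx : UnderZ L c.k z x) : x ∈ c.sq c.k := by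
  rw [mem_lamS_top_iff] at hz
  exact c.mem_sq_top_of_inTop hLo hz.1 hz.2 hx

end CubeB8DZ

end Cube

/-! ## §2. `GaugedBoundB8DZ U₀ □ r` = (1.135)–(1.138) ∕ (152)–(153) with the number `r`, read on the dented tower, RECORD structure -/

section Gauged

variable {d : ℕ} {𝔸 : Type*} [CStarAlgebra 𝔸]

/-- (RECORD TWIN of `Node00.GaugedBoundB8D`.) **(1.135)–(1.138) OF [6] PROPOSITION 6 ∕ (152)–(153) OF [15] WITH THE NUMBER `r`, ON THE DENTED TOWER, FOR THE RECORD's AVERAGING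
STRUCTURE** — the twelve clauses of `GaugedBoundB8D` under the token map: «there exists a gauge transformation u defined on □̃» — unitary, `= 1` off `Ω′₀`, (1.29) «ū_j = 1 on
Λ′_j» for the RECORD averages (`Restr129Z`), the Landau gauge (1.138)∕(153) in the RECORD multiplier form (`IsLandau138WZ`) for `U₁ = U₀″^{u⁻¹}` at background `1`, the
exponential form with `A` Hermitian and «Lʲη|A| ≤ r» on the sides touching `Ω′_j`, `w = v⁻¹u` unitary with `U₀^{w⁻¹} = U₁` on the CENTRED `□̃`, «(Lʲη)²|∇^η A|, (Lʲη)³|∂^{η*}∂^η A|,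
(Lʲη)³|Δ^η A| ≤ r on Ω′_j» in the scaled sup norms, and (1.137)'s identity `Q_k(ηA) = log Ū₀′ᵏ` with the RECORD averages (`logCovIterZ`, `avgIterZ`) on the bonds of `□^{(k)}` over
`Ω_k`.  NEVER asserted; the R6 re-key concludes it, the R7 door consumes it.
[cite: Balaban1985RegularSpaces, Prop. 6 (1.135)–(1.138) p.99, (1.29) p.81; Balaban1985Variational, (152)–(153) p.301 («ū_j = 1 on Λ′_j», «R is defined for the sequence {Ω′_j}»); Balaban1987RG1, (0.4) p.253] -/
def GaugedBoundB8DZ (L : ℕ) {K : ℕ} {Ω : ℕ → Set (B7Prop1Explicit.Site d)} (η : ℝ) (U₀ : B7Prop1Explicit.Site d → Fin d → 𝔸ˣ) (c : CubeB8DZ d L K Ω) (r : ℝ) : Prop :=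
  ∃ u : B7Prop1Explicit.Site d → 𝔸ˣ, (∀ x, u x ∈ unitaryUnits 𝔸) ∧ (∀ x, x ∉ c.sq 0 → u x = 1) ∧
    Restr129Z L c.k c.lamS (1 : B7Prop1Explicit.Site d → Fin d → 𝔸ˣ) u ∧
    IsLandau138WZ L c.k η (c.sq 0) c.lamS (1 : B7Prop1Explicit.Site d → Fin d → 𝔸ˣ) (c.fixed U₀ u) ∧
    (∀ j, j ≤ c.k → ∀ b ∈ {b : B7Prop1Explicit.Site d × Fin d | SideTouches (c.sq j) b.1 b.2},
      c.fixed U₀ u b.1 b.2 = cfgExp η (logCfg η (c.fixed U₀ u)) b.1 b.2 ∧ IsSelfAdjoint (logCfg η (c.fixed U₀ u) b.1 b.2) ∧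
        ‖logCfg η (c.fixed U₀ u) b.1 b.2‖ ≤ r * ((L : ℝ) ^ j * η)⁻¹) ∧
    (∀ x, ((c.vfix U₀)⁻¹ * u) x ∈ unitaryUnits 𝔸) ∧
    AgreeOn (B8Ineq130Rec.tlo L (tLo c.a c.ρ) c.k) (B8Ineq130Rec.thi L (tHi c.a c.M c.ρ) c.k) (gaugeAct ((c.vfix U₀)⁻¹ * u)⁻¹ U₀) (c.fixed U₀ u) ∧
    msup L c.k η (-(2 : ℝ)) (fun j (t : Fin d × Fin d × B7Prop1Explicit.Site d) => SideTouches (c.sq j) t.2.2 t.2.1)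
        (fun t => covDerivFwd η (1 : B7Prop1Explicit.Site d → Fin d → 𝔸ˣ) t.1 (fun z => c.expo η U₀ u z t.2.1) t.2.2) ≤ r ∧
    bondNorm L c.k η (-(3 : ℝ)) c.sq
        (fun x μ => pdiv η (1 : B7Prop1Explicit.Site d → Fin d → 𝔸ˣ) (plaqCovDeriv η (1 : B7Prop1Explicit.Site d → Fin d → 𝔸ˣ) (c.expo η U₀ u)) μ x) ≤ r ∧
    bondNorm L c.k η (-(3 : ℝ)) c.sq (fun x μ => covLap η (1 : B7Prop1Explicit.Site d → Fin d → 𝔸ˣ) (fun z => c.expo η U₀ u z μ) x) ≤ r ∧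
    (∀ (x : B7Prop1Explicit.Site d) (μ : Fin d), bLoZ L c.a 0 0 ≤ x → x + e μ ≤ bHiZ L c.a c.M 0 0 → c.inTop x → c.inTop (x + e μ) →
      logCovIterZ L (1 : B7Prop1Explicit.Site d → Fin d → 𝔸ˣ) (iEta η (c.expo η U₀ u)) c.k x μ = mlog ((avgIterZ L (c.axial U₀) c.k x μ : 𝔸ˣ) : 𝔸))

/-- **KERNEL COHERENCE** (bookkeeping): the twelve clauses in RAW record letters (`cubeFamZ false … ∩ {j = k → · ∈ Ω_k}`, `CubeB8DZ.lamS`, `cutFixedZ`, `localGaugeZ`) assemble to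
`GaugedBoundB8DZ L η U₀ c r` (anonymous constructor; the abbreviations unfold by `rfl`). [cite: Balaban1985RegularSpaces, Prop. 6 (1.135)–(1.138) p.99; Balaban1985Variational, (152)–(153) p.301; Balaban1987RG1, (0.4) p.253] -/
theorem gaugedBoundB8DZ_intro (L : ℕ) {K : ℕ} {Ω : ℕ → Set (B7Prop1Explicit.Site d)} (η : ℝ) (U₀ : B7Prop1Explicit.Site d → Fin d → 𝔸ˣ)
    (c : CubeB8DZ d L K Ω) (r : ℝ) (u : B7Prop1Explicit.Site d → 𝔸ˣ) (hu : ∀ x, u x ∈ unitaryUnits 𝔸)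
    (huS : ∀ x, x ∉ c.sq 0 → u x = 1)
    (h129 : Restr129Z L c.k c.lamS (1 : B7Prop1Explicit.Site d → Fin d → 𝔸ˣ) u)
    (h138 : IsLandau138WZ L c.k η (c.sq 0) c.lamS (1 : B7Prop1Explicit.Site d → Fin d → 𝔸ˣ)
      (gaugeAct u⁻¹ (cutFixedZ L (tLo c.a c.ρ) (tHi c.a c.M c.ρ) U₀ c.k (ctr c.a c.M))))
    (h162 : ∀ j, j ≤ c.k → ∀ b ∈ {b : B7Prop1Explicit.Site d × Fin d | SideTouches (c.sq j) b.1 b.2},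
      gaugeAct u⁻¹ (cutFixedZ L (tLo c.a c.ρ) (tHi c.a c.M c.ρ) U₀ c.k (ctr c.a c.M)) b.1 b.2 =
          cfgExp η (logCfg η (gaugeAct u⁻¹ (cutFixedZ L (tLo c.a c.ρ) (tHi c.a c.M c.ρ) U₀ c.k (ctr c.a c.M)))) b.1 b.2 ∧
        IsSelfAdjoint (logCfg η (gaugeAct u⁻¹ (cutFixedZ L (tLo c.a c.ρ) (tHi c.a c.M c.ρ) U₀ c.k (ctr c.a c.M))) b.1 b.2) ∧
        ‖logCfg η (gaugeAct u⁻¹ (cutFixedZ L (tLo c.a c.ρ) (tHi c.a c.M c.ρ) U₀ c.k (ctr c.a c.M))) b.1 b.2‖ ≤ r * ((L : ℝ) ^ j * η)⁻¹)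
    (hw : ∀ x, ((localGaugeZ L (tLo c.a c.ρ) (tHi c.a c.M c.ρ) U₀ c.k (ctr c.a c.M))⁻¹ * u) x ∈ unitaryUnits 𝔸)
    (h135 : AgreeOn (B8Ineq130Rec.tlo L (tLo c.a c.ρ) c.k) (B8Ineq130Rec.thi L (tHi c.a c.M c.ρ) c.k)
      (gaugeAct ((localGaugeZ L (tLo c.a c.ρ) (tHi c.a c.M c.ρ) U₀ c.k (ctr c.a c.M))⁻¹ * u)⁻¹ U₀)
      (gaugeAct u⁻¹ (cutFixedZ L (tLo c.a c.ρ) (tHi c.a c.M c.ρ) U₀ c.k (ctr c.a c.M))))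
    (h136₂ : msup L c.k η (-(2 : ℝ)) (fun j (t : Fin d × Fin d × B7Prop1Explicit.Site d) => SideTouches (c.sq j) t.2.2 t.2.1)
      (fun t => covDerivFwd η (1 : B7Prop1Explicit.Site d → Fin d → 𝔸ˣ) t.1
        (fun z => mlogCfg c.k η c.sq (gaugeAct u⁻¹ (cutFixedZ L (tLo c.a c.ρ) (tHi c.a c.M c.ρ) U₀ c.k (ctr c.a c.M))) z t.2.1) t.2.2) ≤ r)
    (h136₃ : bondNorm L c.k η (-(3 : ℝ)) c.sq
      (fun x μ => pdiv η (1 : B7Prop1Explicit.Site d → Fin d → 𝔸ˣ) (plaqCovDeriv η (1 : B7Prop1Explicit.Site d → Fin d → 𝔸ˣ)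
        (mlogCfg c.k η c.sq (gaugeAct u⁻¹ (cutFixedZ L (tLo c.a c.ρ) (tHi c.a c.M c.ρ) U₀ c.k (ctr c.a c.M))))) μ x) ≤ r)
    (h136₄ : bondNorm L c.k η (-(3 : ℝ)) c.sq
      (fun x μ => covLap η (1 : B7Prop1Explicit.Site d → Fin d → 𝔸ˣ)
        (fun z => mlogCfg c.k η c.sq (gaugeAct u⁻¹ (cutFixedZ L (tLo c.a c.ρ) (tHi c.a c.M c.ρ) U₀ c.k (ctr c.a c.M))) z μ) x) ≤ r)
    (h137 : ∀ (x : B7Prop1Explicit.Site d) (μ : Fin d), bLoZ L c.a 0 0 ≤ x → x + e μ ≤ bHiZ L c.a c.M 0 0 → c.inTop x → c.inTop (x + e μ) →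
      logCovIterZ L (1 : B7Prop1Explicit.Site d → Fin d → 𝔸ˣ)
          (iEta η (mlogCfg c.k η c.sq (gaugeAct u⁻¹ (cutFixedZ L (tLo c.a c.ρ) (tHi c.a c.M c.ρ) U₀ c.k (ctr c.a c.M))))) c.k x μ =
        mlog ((avgIterZ L (gaugeAct (localGaugeZ L (tLo c.a c.ρ) (tHi c.a c.M c.ρ) U₀ c.k (ctr c.a c.M)) U₀) c.k x μ : 𝔸ˣ) : 𝔸)) :
    GaugedBoundB8DZ L η U₀ c r :=
  ⟨u, hu, huS, h129, h138, h162, hw, h135, h136₂, h136₃, h136₄, h137⟩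

/-- The gauge of `GaugedBoundB8DZ` satisfies (1.29) for the DENTED cells, RECORD averages — the conjunct the N07 road reads. [cite: Balaban1985Variational, (152) p.301; Balaban1985RegularSpaces, (1.29) p.81; Balaban1987RG1, (0.4) p.253] -/
theorem GaugedBoundB8DZ.exists_restr129 {L K : ℕ} {Ω : ℕ → Set (B7Prop1Explicit.Site d)} {η : ℝ} {U₀ : B7Prop1Explicit.Site d → Fin d → 𝔸ˣ} {c : CubeB8DZ d L K Ω}
    {r : ℝ} (h : GaugedBoundB8DZ L η U₀ c r) :
    ∃ u : B7Prop1Explicit.Site d → 𝔸ˣ, (∀ x, u x ∈ unitaryUnits 𝔸) ∧ (∀ x, x ∉ c.sq 0 → u x = 1) ∧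
      Restr129Z L c.k c.lamS (1 : B7Prop1Explicit.Site d → Fin d → 𝔸ˣ) u ∧
      IsLandau138WZ L c.k η (c.sq 0) c.lamS (1 : B7Prop1Explicit.Site d → Fin d → 𝔸ˣ) (c.fixed U₀ u) := by
  obtain ⟨u, hu, huS, h129, h138, -⟩ := h
  exact ⟨u, hu, huS, h129, h138⟩

/-- At a dented cube `c`, the ambient hypothesis `U₀ ∈ 𝔄_K({Ω_j}, α₀)` gives `U₀ ∈ 𝔄_{c.k}({Ω_j}, α₀)` (`c.k_le`; print's «drop the domains Ω_{j′}, j′ > j»).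
[cite: Balaban1985RegularSpaces, p.98; Balaban1985Variational, p.300 («intersecting Ω_j but not Ω_{j+1}»)] -/
theorem CubeB8DZ.inAk {𝔹 : Type*} [NormedRing 𝔹] [NormedAlgebra ℂ 𝔹] {L K : ℕ} {Ω : ℕ → Set (B7Prop1Explicit.Site d)} (c : CubeB8DZ d L K Ω) {η α : ℝ}
    {V : B7Prop1Explicit.Site d → Fin d → 𝔹ˣ} (h : InAk L K η α Ω V) : InAk L c.k η α Ω V :=
  inAk_of_le c.k_le h

end Gauged

/-! ## §3. Non-vacuity -/

section NonVacuity

variable {d : ℕ}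

/-- In an ambient family with `Ω_k = Ω_{k−1} = T` every cube datum with print's size laws is a dented record datum (the block law and «□̃ ⊂ Ω_{k−1}» are automatic; the dent is
empty). [cite: Balaban1985RegularSpaces, p.98; Balaban1985Variational, p.300] -/
def CubeB8DZ.ofUniv {L K : ℕ} {Ω : ℕ → Set (B7Prop1Explicit.Site d)} (k : ℕ) (a : B7Prop1Explicit.Site d) (M ρ : ℕ) (hk : 1 ≤ k) (hkK : k ≤ K) (hLρ : L ≤ ρ)
    (hρM : ρ ≤ M) (hbig : 11 * d < M) (hLdM : L ≤ d * M) (hΩ : Ω k = Set.univ) (hΩ' : Ω (k - 1) = Set.univ) : CubeB8DZ d L K Ω :=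
  ⟨k, a, M, ρ, hk, hkK, hLρ, hρM, hbig, hLdM, by rw [hΩ']; exact Set.subset_univ _, fun _ _ _ _ => by rw [hΩ]; exact Set.mem_univ _⟩

/-- The datum `ofUniv` has the prescribed scale index (bookkeeping). [cite: Balaban1985RegularSpaces, p.98; Balaban1985Variational, p.300] -/
theorem CubeB8DZ.ofUniv_k {L K : ℕ} {Ω : ℕ → Set (B7Prop1Explicit.Site d)} (k : ℕ) (a : B7Prop1Explicit.Site d) (M ρ : ℕ) (hk : 1 ≤ k) (hkK : k ≤ K)
    (hLρ : L ≤ ρ) (hρM : ρ ≤ M) (hbig : 11 * d < M) (hLdM : L ≤ d * M) (hΩ : Ω k = Set.univ) (hΩ' : Ω (k - 1) = Set.univ) :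
    (CubeB8DZ.ofUniv k a M ρ hk hkK hLρ hρM hbig hLdM hΩ hΩ').k = k := rfl

/-- **THE DENTED RECORD CUBE TYPE IS INHABITED** over any ambient family with `Ω_K = Ω_{K−1} = T`, `K ≥ 1`, `d ≥ 1`: scale `K`, corner `0`, `ρ := L`, side `max L (11d + 1)`.
[cite: Balaban1985Variational, p.300; Balaban1985RegularSpaces, p.98] -/
theorem CubeB8DZ.nonempty_of_univ {L K : ℕ} {Ω : ℕ → Set (B7Prop1Explicit.Site d)} (hd : 1 ≤ d) (hK : 1 ≤ K) (hΩ : Ω K = Set.univ)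
    (hΩ' : Ω (K - 1) = Set.univ) : Nonempty (CubeB8DZ d L K Ω) :=
  ⟨CubeB8DZ.ofUniv K 0 (max L (11 * d + 1)) L hK le_rfl le_rfl (le_max_left _ _) (Nat.lt_of_lt_of_le (Nat.lt_succ_self _) (le_max_right _ _))
    ((le_max_left _ _).trans (le_mul_of_one_le_left (Nat.zero_le _) hd)) hΩ hΩ'⟩

end NonVacuity

/-! ## §4. The (T2) dictionary: the dented record tower and its block law read through `x ↦ x + ctrShift L k·𝟙` -/

section Dictionary

variable {d : ℕ} {L K : ℕ} {Ω : ℕ → Set (B7Prop1Explicit.Site d)} (c : CubeB8DZ d L K Ω)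

/-- ★ **The dented record tower through the translation** (odd `L`): `x ∈ Ω′_j` iff `x + c_k` lies in the ENGINE member `cubeFam false L a M ρ k j` of the same datum `(a, M, ρ, k)` and
(`j = k` only) `x ∈ Ω_k` — `B8Eq131CubesAdmissibleRec.mem_cubeFamZ_iff_add_ctrShift` under the dent. [cite: Balaban1987RG1, (0.3) p.252; Balaban1985Variational, (148)–(150) p.301] -/
theorem CubeB8DZ.mem_sq_iff_add_ctrShift (hLo : Odd L) (j : ℕ) (x : B7Prop1Explicit.Site d) :
    x ∈ c.sq j ↔ (x + fun _ => (ctrShift L c.k : ℤ)) ∈ cubeFam false L c.a c.M c.ρ c.k j ∧ (j = c.k → x ∈ Ω c.k) := by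
  simp only [CubeB8DZ.sq, Set.mem_inter_iff, Set.mem_setOf_eq, B8Eq131CubesAdmissibleRec.mem_cubeFamZ_iff_add_ctrShift hLo]

/-- ★ **The centred block law is the engine block law of the translated family** (odd `L`): `c.inTop z` iff every fine `x` with `x + c_k` in the CORNER `k`-block of `z` lies in
`Ω_k` (`B8Eq131CubesRecDictionary.underZ_iff_under_add_ctrShift_self`). [cite: Balaban1987RG1, (0.3) p.252; Balaban1985RegularSpaces, (1.3)/(1.6) p.77] -/
theorem CubeB8DZ.inTop_iff_under_add_ctrShift (hLo : Odd L) (z : B7Prop1Explicit.Site d) :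
    c.inTop z ↔ ∀ x, Under L c.k z (x + fun _ => (ctrShift L c.k : ℤ)) → x ∈ Ω c.k := by
  simp only [CubeB8DZ.inTop, B8Eq131CubesRecDictionary.underZ_iff_under_add_ctrShift_self hLo]

/-- ★ The field `blocks` in ENGINE letters (odd `L`): `Ω_k` is saturated for the fibres of `x ↦ flm L k (x + c_k)` (`= flmZ L k x`, `B8Eq131CubesRecDictionary.flm_add_ctrShift_self`).
[cite: Balaban1987RG1, (0.3) p.252; Balaban1985RegularSpaces, (1.3) p.77] -/
theorem CubeB8DZ.blocks_flm_add_ctrShift (hLo : Odd L) {x y : B7Prop1Explicit.Site d}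
    (h : flm L c.k (x + fun _ => (ctrShift L c.k : ℤ)) = flm L c.k (y + fun _ => (ctrShift L c.k : ℤ))) (hx : x ∈ Ω c.k) : y ∈ Ω c.k := by
  rw [B8Eq131CubesRecDictionary.flm_add_ctrShift_self hLo, B8Eq131CubesRecDictionary.flm_add_ctrShift_self hLo] at h
  exact c.blocks h hx

end Dictionary

end Literature.MathematicalPhysics.QuantumFieldTheory.Balaban1983to89.Node00

end

/-! ## Axiom audit (gate whitelist: `propext`, `Classical.choice`, `Quot.sound`) -/
#print axioms Literature.MathematicalPhysics.QuantumFieldTheory.Balaban1983to89.Node00.gaugedBoundB8DZ_intro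
#print axioms Literature.MathematicalPhysics.QuantumFieldTheory.Balaban1983to89.Node00.CubeB8DZ.sq_top_blockSat
#print axioms Literature.MathematicalPhysics.QuantumFieldTheory.Balaban1983to89.Node00.CubeB8DZ.mem_sq_iff_add_ctrShift
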